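import Mathlib
import HarnessLib
import Summits.Ventures.LatticeQCDFlow.Scaling.PlaquetteTopLinkDensity
import Summits.Ventures.LatticeQCDFlow.Scaling.TorusPlaquetteLastLinks
import Summits.Ventures.LatticeQCDFlow.Scaling.AutoregressiveGaugeHeatBathComb

/-!
# LatticeQCDFlow / Scaling — the dimension gap of one-plaquette heat-bath autoregression: the fewest
# plaquettes left outside a RANKED collection of `(ℤ/L)^d` is exactly `1` in `d = 2` and at least a sixth
# of all plaquettes in `d ≥ 3`

HONEST FRAMING: exact (Metropolis-corrected) sampling algorithms for lattice gauge theory;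
figures of merit are autocorrelation/cost numbers at stated couplings and volumes; no
continuum-physics claim.

Venture `LatticeQCDFlow` (cell pub-lqcd), topic `Scaling`, FANOUT row 30 (lean-1, GEN-24) — OUR WORK on
THEORY-2.md §4 row C5.  A collection `B` of plaquettes of `(ℤ/L)^d` RANKED for a top-link assignment `t`
injective on `B` (`t p` a link of `p`; `rank p < rank p'` whenever `t p` lies on another `p' ∈ B`) is
exactly the combinatorial datum on which the one-plaquette heat-bath autoregressive model is an
implementable EXACT sampler of the block law `(F_B/Z_B)·Haar^{⊗E}` (`Scaling/AutoregressiveGaugeHeatBathRanked`,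
`…Comb`); used as an independence proposal for the full weight `∏_{all p} w(U_p)` its importance ratio
carries the `k = #Bᶜ` plaquettes left outside, and the lineage's Doeblin law gives acceptance
`≥ (m/M)^k` and `τ_int ≤ (M/m)^k − 1/2` (`…TorusPerimeter`, `…TorusTauInt`).  THIS FILE: how small can `k`
be?

* §1 **`not_ranked_univ`** (`d ≥ 2`, `L ≥ 2`): the whole periodic lattice is never ranked — for every
  injective `t` and every `rank` some pair violates the rank condition (`PlaquetteTopLinkOrders` §4 would
  give an order with every plaquette good, §2 forbids it); **`one_le_card_compl_of_ranked`**: `k ≥ 1` for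
  every ranked `(B, t)`.
* §2 **`card_plaquette_le_six_mul_card_compl_of_ranked`** (`d ≥ 3`): `#plaquettes ≤ 6k` for every ranked
  `(B, t)` (the sub-complex law of `PlaquetteTopLinkDensity` through the order of §4), i.e.
  **`card_site_mul_le_twelve_mul_card_compl_of_ranked`**: `#sites·d(d−1) ≤ 12k` — `k ≥ L³/2` in `d = 3`,
  `k ≥ L⁴` in `d = 4`: a VOLUME of plaquettes rides on the importance ratio.
* §3 **`exists_ranked_card_compl_eq_one`** (`d = 2`, `L ≥ 2`): the comb is ranked, injective, and leaves
  exactly ONE plaquette outside — with §1 the minimum of `k` in two dimensions is exactly `1`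
  (**`dimensionGap_two`**), against **`dimensionGap_three_le`** in `d ≥ 3`.

No `def`, no `sorry`, nothing cited as a fact beyond the tree.
-/

namespace Summit.Ventures.LatticeQCDFlow.Theory2.Autoregressive

open Finset
open Literature.MathematicalPhysics.QuantumFieldTheory

variable {d L : ℕ} [NeZero L]

/-! ## §1 The whole lattice is never ranked: `k ≥ 1` in every dimension -/

/-- **The periodic lattice `(ℤ/L)^d` (`d ≥ 2`, `L ≥ 2`) carries no ranked one-plaquette structure**: for
every injective assignment `t` of a link `t p ∈ p` to every plaquette and every `rank : plaquettes → ℕ`,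
the rank condition fails for some pair. [ours] -/
theorem not_ranked_univ (hd : 2 ≤ d) (hL : 2 ≤ L) (t : Plaquette d L → Edge d L)
    (hinj : Function.Injective t) (rank : Plaquette d L → ℕ) :
    ¬ ∀ p p' : Plaquette d L, p ≠ p' → t p ∈ ({(p'.1, p'.2.1.1), (p'.1.shift p'.2.1.1, p'.2.1.2),
        (p'.1.shift p'.2.1.2, p'.2.1.1), (p'.1, p'.2.1.2)} : Finset (Edge d L)) → rank p < rank p' := by
  intro hrank
  obtain ⟨l, -, -, hgood⟩ := exists_order_of_topLink_rank (Finset.univ : Finset (Plaquette d L)) t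
    hinj.injOn rank (fun p _ p' _ hne hmem => hrank p p' hne hmem)
  exact not_forall_topLink_last hd hL t hinj l fun p e' he' hne => hgood p (Finset.mem_univ _) e' he' hne

/-- **`k ≥ 1`**: a ranked collection with an injective top-link assignment leaves at least one plaquette of
`(ℤ/L)^d` outside (`d ≥ 2`, `L ≥ 2`). [ours] -/
theorem one_le_card_compl_of_ranked (hd : 2 ≤ d) (hL : 2 ≤ L) (B : Finset (Plaquette d L))
    (t : Plaquette d L → Edge d L) (hinj : Set.InjOn t B) (rank : Plaquette d L → ℕ)
    (hrank : ∀ p ∈ B, ∀ p' ∈ B, p ≠ p' → t p ∈ ({(p'.1, p'.2.1.1), (p'.1.shift p'.2.1.1, p'.2.1.2),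
        (p'.1.shift p'.2.1.2, p'.2.1.1), (p'.1, p'.2.1.2)} : Finset (Edge d L)) → rank p < rank p') :
    1 ≤ (Finset.univ \ B).card := by
  by_contra h0
  have hempty : Finset.univ \ B = ∅ := by
    rw [← Finset.card_eq_zero]; omega
  have hB : B = Finset.univ :=
    Finset.eq_univ_of_forall fun p => by
      by_contra hp
      have : p ∈ Finset.univ \ B := Finset.mem_sdiff.2 ⟨Finset.mem_univ _, hp⟩
      rw [hempty] at this
      exact Finset.notMem_empty _ this
  subst hB
  have hinj' : Function.Injective t := by
    intro p p' h
    exact hinj (Finset.mem_coe.2 (Finset.mem_univ p)) (Finset.mem_coe.2 (Finset.mem_univ p')) h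
  exact not_ranked_univ hd hL t hinj' rank fun p p' hne hmem =>
    hrank p (Finset.mem_univ _) p' (Finset.mem_univ _) hne hmem

/-! ## §2 `d ≥ 3`: a sixth of all plaquettes stays outside -/

/-- **`#plaquettes ≤ 6k` in `d ≥ 3`**: a ranked collection `B` with an injective top-link assignment misses
at least a sixth of the plaquettes of `(ℤ/L)^d` (the sub-complex law along the order of
`exists_order_of_topLink_rank`). [ours] -/
theorem card_plaquette_le_six_mul_card_compl_of_ranked (hd : 3 ≤ d) (B : Finset (Plaquette d L))
    (t : Plaquette d L → Edge d L)
    (ht : ∀ p ∈ B, t p ∈ ({(p.1, p.2.1.1), (p.1.shift p.2.1.1, p.2.1.2),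
        (p.1.shift p.2.1.2, p.2.1.1), (p.1, p.2.1.2)} : Finset (Edge d L)))
    (hinj : Set.InjOn t B) (rank : Plaquette d L → ℕ)
    (hrank : ∀ p ∈ B, ∀ p' ∈ B, p ≠ p' → t p ∈ ({(p'.1, p'.2.1.1), (p'.1.shift p'.2.1.1, p'.2.1.2),
        (p'.1.shift p'.2.1.2, p'.2.1.1), (p'.1, p'.2.1.2)} : Finset (Edge d L)) → rank p < rank p') :
    Fintype.card (Plaquette d L) ≤ 6 * (Finset.univ \ B).card := by
  obtain ⟨l, -, -, hgood⟩ := exists_order_of_topLink_rank B t hinj rank hrank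
  exact card_plaquette_le_six_mul_card_compl_of_good hd B t ht hinj l hgood

/-- **`#sites · d(d−1) ≤ 12k` in `d ≥ 3`** (so `k ≥ L³/2` for `d = 3`, `k ≥ L⁴` for `d = 4`): the number of
plaquettes a ranked structure must leave outside grows with the VOLUME. [ours] -/
theorem card_site_mul_le_twelve_mul_card_compl_of_ranked (hd : 3 ≤ d) (B : Finset (Plaquette d L))
    (t : Plaquette d L → Edge d L)
    (ht : ∀ p ∈ B, t p ∈ ({(p.1, p.2.1.1), (p.1.shift p.2.1.1, p.2.1.2),
        (p.1.shift p.2.1.2, p.2.1.1), (p.1, p.2.1.2)} : Finset (Edge d L)))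
    (hinj : Set.InjOn t B) (rank : Plaquette d L → ℕ)
    (hrank : ∀ p ∈ B, ∀ p' ∈ B, p ≠ p' → t p ∈ ({(p'.1, p'.2.1.1), (p'.1.shift p'.2.1.1, p'.2.1.2),
        (p'.1.shift p'.2.1.2, p'.2.1.1), (p'.1, p'.2.1.2)} : Finset (Edge d L)) → rank p < rank p') :
    Fintype.card (Site d L) * (d * (d - 1)) ≤ 12 * (Finset.univ \ B).card := by
  have h := card_plaquette_le_six_mul_card_compl_of_ranked hd B t ht hinj rank hrank
  have h2 := two_mul_card_plaquette d L
  omega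

/-! ## §3 `d = 2`: the comb leaves exactly one plaquette outside -/

/-- **In two dimensions `k = 1` is attained** (`L ≥ 2`): the comb of `Scaling/AutoregressiveGaugeHeatBathComb`
is an injective top-link assignment ranked on all plaquettes of `(ℤ/L)²` but one. [ours] -/
theorem exists_ranked_card_compl_eq_one (hL : 2 ≤ L) :
    ∃ (B : Finset (Plaquette 2 L)) (t : Plaquette 2 L → Edge 2 L) (rank : Plaquette 2 L → ℕ),
      Set.InjOn t B ∧
      (∀ p ∈ B, t p ∈ ({(p.1, p.2.1.1), (p.1.shift p.2.1.1, p.2.1.2),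
        (p.1.shift p.2.1.2, p.2.1.1), (p.1, p.2.1.2)} : Finset (Edge 2 L))) ∧
      (∀ p ∈ B, ∀ p' ∈ B, p ≠ p' → t p ∈ ({(p'.1, p'.2.1.1), (p'.1.shift p'.2.1.1, p'.2.1.2),
        (p'.1.shift p'.2.1.2, p'.2.1.1), (p'.1, p'.2.1.2)} : Finset (Edge 2 L)) → rank p < rank p') ∧
      (Finset.univ \ B).card = 1 :=
  ⟨Finset.univ.erase (((![-1, -1] : Site 2 L), ⟨((0 : Fin 2), (1 : Fin 2)), by decide⟩) : Plaquette 2 L),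
    fun p => if p.1 1 = -1 then (p.1.shift 0, (1 : Fin 2)) else (p.1.shift 1, (0 : Fin 2)),
    fun r => if r.1 1 = -1 then L + (r.1 0).val else (r.1 1).val,
    comb_injective.injOn, fun p _ => comb_mem_links p, comb_rank_lt hL, card_univ_sdiff_erase _⟩

/-- **THE DIMENSION GAP, `d = 2`**: over all ranked collections with an injective top-link assignment of
`(ℤ/L)²` (`L ≥ 2`) the least number of plaquettes left outside is EXACTLY `1` — attained (the comb) and
never `0`. [ours] -/
theorem dimensionGap_two (hL : 2 ≤ L) :
    (∃ (B : Finset (Plaquette 2 L)) (t : Plaquette 2 L → Edge 2 L) (rank : Plaquette 2 L → ℕ),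
      Set.InjOn t B ∧
      (∀ p ∈ B, t p ∈ ({(p.1, p.2.1.1), (p.1.shift p.2.1.1, p.2.1.2),
        (p.1.shift p.2.1.2, p.2.1.1), (p.1, p.2.1.2)} : Finset (Edge 2 L))) ∧
      (∀ p ∈ B, ∀ p' ∈ B, p ≠ p' → t p ∈ ({(p'.1, p'.2.1.1), (p'.1.shift p'.2.1.1, p'.2.1.2),
        (p'.1.shift p'.2.1.2, p'.2.1.1), (p'.1, p'.2.1.2)} : Finset (Edge 2 L)) → rank p < rank p') ∧
      (Finset.univ \ B).card = 1) ∧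
    ∀ (B : Finset (Plaquette 2 L)) (t : Plaquette 2 L → Edge 2 L) (rank : Plaquette 2 L → ℕ),
      Set.InjOn t B →
      (∀ p ∈ B, ∀ p' ∈ B, p ≠ p' → t p ∈ ({(p'.1, p'.2.1.1), (p'.1.shift p'.2.1.1, p'.2.1.2),
        (p'.1.shift p'.2.1.2, p'.2.1.1), (p'.1, p'.2.1.2)} : Finset (Edge 2 L)) → rank p < rank p') →
      1 ≤ (Finset.univ \ B).card :=
  ⟨exists_ranked_card_compl_eq_one hL, fun B t rank hinj hrank =>
    one_le_card_compl_of_ranked le_rfl hL B t hinj rank hrank⟩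

/-- **THE DIMENSION GAP, `d ≥ 3`**: every ranked collection with an injective top-link assignment of
`(ℤ/L)^d` leaves at least `#plaquettes/6` plaquettes outside (and at least one) — the exponent of the
Doeblin guarantee of every one-plaquette heat-bath proposal is a VOLUME, not the constant `1` of two
dimensions. [ours] -/
theorem dimensionGap_three_le (hd : 3 ≤ d) (B : Finset (Plaquette d L)) (t : Plaquette d L → Edge d L)
    (ht : ∀ p ∈ B, t p ∈ ({(p.1, p.2.1.1), (p.1.shift p.2.1.1, p.2.1.2),
        (p.1.shift p.2.1.2, p.2.1.1), (p.1, p.2.1.2)} : Finset (Edge d L)))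
    (hinj : Set.InjOn t B) (rank : Plaquette d L → ℕ)
    (hrank : ∀ p ∈ B, ∀ p' ∈ B, p ≠ p' → t p ∈ ({(p'.1, p'.2.1.1), (p'.1.shift p'.2.1.1, p'.2.1.2),
        (p'.1.shift p'.2.1.2, p'.2.1.1), (p'.1, p'.2.1.2)} : Finset (Edge d L)) → rank p < rank p') :
    Fintype.card (Plaquette d L) ≤ 6 * (Finset.univ \ B).card ∧
      Fintype.card (Site d L) * (d * (d - 1)) ≤ 12 * (Finset.univ \ B).card :=
  ⟨card_plaquette_le_six_mul_card_compl_of_ranked hd B t ht hinj rank hrank,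
    card_site_mul_le_twelve_mul_card_compl_of_ranked hd B t ht hinj rank hrank⟩

end Summit.Ventures.LatticeQCDFlow.Theory2.Autoregressive
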